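import Mathlib.Algebra.BigOperators.Option
import Mathlib.Algebra.BigOperators.Fin
import Mathlib.Algebra.Order.BigOperators.Group.Finset
import Mathlib.Algebra.Group.Subgroup.Basic
import Mathlib.Algebra.Module.Basic
import Mathlib.Data.Real.Basic
import Mathlib.Data.Fintype.Option
import Mathlib.Tactic.NormNum
import Mathlib.Tactic.Linarith
import Mathlib.Tactic.Abel
import Mathlib.Tactic.Ring
import HarnessLib

/-!
# The Kontsevich–Zagier conjecture in dimension `≤ 1`, II: the peeling induction

The combinatorial heart of the injectivity half of the dimension-`≤ 1` theorem, in abstract form.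
Let `cell : ℝ → M` be a family of elements of an abelian group indexed by a "length" `t`
(think: `cell t = [[1, eᵗ], b/x]`, value `b t`, or `cell θ = [[0, tan θ], b/(1+x²)]`, value `b θ`),
defined on a set `good` of admissible lengths closed under differences, and let `G ≤ M` be a
subgroup (think: `KZ.relations`) containing every PEELING ELEMENT
`cell s − cell t − cell (s − t)` (`0 < t < s` admissible).  Then every INTEGER relation among
admissible positive lengths is realised in `G`:
`Σ_i n_i t_i = 0`, `n_i ∈ ℤ`  ⟹  `Σ_i n_i • cell (t_i) ∈ G`  (`sum_zsmul_mem_of_peel`).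

Proof: induction on `Σ_i |n_i|`.  Pick `i₀` with `n_{i₀} > 0` and `j₀` with `n_{j₀} < 0` (if all
coefficients have one sign they vanish, the lengths being positive).  If `t_{i₀} = t_{j₀}` cancel
one copy of each.  If `t_{i₀} < t_{j₀}` peel the longer cell on the negative side,
`cell t_{j₀} ≡ cell t_{i₀} + cell (t_{j₀} − t_{i₀})`, cancel `cell t_{i₀}`, and recurse with the
new length `t_{j₀} − t_{i₀}` (index type `Option ι`); symmetrically if `t_{i₀} > t_{j₀}`.  In each
case `Σ |n|` drops.  No length is ever enlarged, so no "overflow" (e.g. past `π/2` for angles)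
can occur — this is why the argument works for arctangent cells, where
`arctan 2 + arctan 3 = 3 arctan 1` shows that merging cells instead of peeling them would leave
the admissible range.
-/

namespace Summit.KontsevichZagierPeriods.KontsevichZagierPeriods.Theorems

namespace SoloBlind

open Finset
open scoped BigOperators

universe u v

section Peel

variable {M : Type v} [AddCommGroup M]

/-- A vanishing combination of positive reals with nonnegative integer coefficients has all
coefficients zero. -/
theorem eq_zero_of_sum_cast_mul_eq_zero_of_nonneg {ι : Type u} [Fintype ι] {n : ι → ℤ}
    {t : ι → ℝ} (hpos : ∀ i, 0 < t i) (hn : ∀ i, 0 ≤ n i) (hrel : ∑ i, (n i : ℝ) * t i = 0) :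
    ∀ i, n i = 0 := by
  have hterm : ∀ i ∈ (univ : Finset ι), 0 ≤ (n i : ℝ) * t i :=
    fun i _ => mul_nonneg (by exact_mod_cast hn i) (hpos i).le
  have h0 := (sum_eq_zero_iff_of_nonneg hterm).mp hrel
  intro i
  rcases mul_eq_zero.mp (h0 i (mem_univ i)) with h | h
  · exact_mod_cast h
  · exact absurd h (hpos i).ne'

/-- A vanishing combination of positive reals with nonpositive integer coefficients has all
coefficients zero. -/
theorem eq_zero_of_sum_cast_mul_eq_zero_of_nonpos {ι : Type u} [Fintype ι] {n : ι → ℤ}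
    {t : ι → ℝ} (hpos : ∀ i, 0 < t i) (hn : ∀ i, n i ≤ 0) (hrel : ∑ i, (n i : ℝ) * t i = 0) :
    ∀ i, n i = 0 := by
  have h := eq_zero_of_sum_cast_mul_eq_zero_of_nonneg (n := fun i => -n i) hpos
    (fun i => by simpa using hn i)
    (by simp only [Int.cast_neg, neg_mul, sum_neg_distrib, hrel, neg_zero])
  intro i
  simpa using h i

variable (G : AddSubgroup M) (good : ℝ → Prop) (cell : ℝ → M)

/-- The peeling induction, with an explicit bound `Σ_i |n_i| ≤ k` to induct on. -/
theorem sum_zsmul_mem_of_peel_aux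
    (hgood : ∀ ⦃t s : ℝ⦄, good t → good s → t < s → good (s - t))
    (hpeel : ∀ ⦃t s : ℝ⦄, good t → good s → 0 < t → t < s → cell s - cell t - cell (s - t) ∈ G)
    (k : ℕ) :
    ∀ {ι : Type u} [Fintype ι] (n : ι → ℤ) (t : ι → ℝ), (∀ i, 0 < t i) → (∀ i, good (t i)) →
      ∑ i, (n i : ℝ) * t i = 0 → ∑ i, |n i| ≤ (k : ℤ) → ∑ i, n i • cell (t i) ∈ G := by
  induction k with
  | zero =>
    intro ι _ n t _ _ _ hk
    have h0 : ∀ i, n i = 0 := by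
      intro i
      have h1 : |n i| ≤ ∑ j, |n j| :=
        single_le_sum (f := fun j => |n j|) (fun j _ => abs_nonneg (n j)) (mem_univ i)
      have h2 : |n i| ≤ 0 := h1.trans (by simpa using hk)
      exact abs_nonpos_iff.mp h2
    simp [h0, G.zero_mem]
  | succ k ih =>
    intro ι _ n t hpos hg hrel hk
    classical
    by_cases hall : ∀ i, n i = 0
    · simp [hall, G.zero_mem]
    -- coefficients of both signs occur
    obtain ⟨i₀, j₀, hi₀, hj₀⟩ : ∃ i₀ j₀, 0 < n i₀ ∧ n j₀ < 0 := by
      by_cases hex : ∃ i, 0 < n i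
      · obtain ⟨i, hi⟩ := hex
        by_cases hex' : ∃ j, n j < 0
        · obtain ⟨j, hj⟩ := hex'
          exact ⟨i, j, hi, hj⟩
        · exfalso
          apply hall
          exact eq_zero_of_sum_cast_mul_eq_zero_of_nonneg hpos
            (fun j => not_lt.mp fun h => hex' ⟨j, h⟩) hrel
      · exfalso
        apply hall
        exact eq_zero_of_sum_cast_mul_eq_zero_of_nonpos hpos
          (fun j => not_lt.mp fun h => hex ⟨j, h⟩) hrel
    have hne : i₀ ≠ j₀ := by
      rintro rfl
      exact lt_irrefl _ (hi₀.trans hj₀)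
    have hne' : j₀ ≠ i₀ := fun h => hne h.symm
    -- cancel one copy of `cell (t i₀)` against one copy of `cell (t j₀)`
    set n₁ : ι → ℤ := fun i => n i - (if i = i₀ then 1 else 0) + (if i = j₀ then 1 else 0)
      with hn₁
    have habs : ∀ i, |n₁ i| = |n i| - (if i = i₀ then 1 else 0) - (if i = j₀ then 1 else 0) := by
      intro i
      by_cases h1 : i = i₀
      · subst h1
        simp only [hn₁, if_true, if_neg hne]
        rw [abs_of_pos hi₀, abs_of_nonneg (by omega)]
        ring
      · by_cases h2 : i = j₀
        · subst h2
          simp only [hn₁, if_true, if_neg hne']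
          rw [abs_of_neg hj₀, abs_of_nonpos (by omega)]
          ring
        · simp [hn₁, h1, h2]
    have hsum_abs : ∑ i, |n₁ i| = ∑ i, |n i| - 2 := by
      simp only [habs, sum_sub_distrib, sum_ite_eq', mem_univ, if_true]
      ring
    have hsum_cell : ∑ i, n₁ i • cell (t i) =
        ∑ i, n i • cell (t i) - cell (t i₀) + cell (t j₀) := by
      simp only [hn₁, sub_smul, add_smul, ite_smul, one_smul, zero_smul, sum_add_distrib,
        sum_sub_distrib, sum_ite_eq', mem_univ, if_true]
    have hsum_rel : ∑ i, (n₁ i : ℝ) * t i = ∑ i, (n i : ℝ) * t i - t i₀ + t j₀ := by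
      simp only [hn₁, Int.cast_add, Int.cast_sub, Int.cast_ite, Int.cast_one, Int.cast_zero,
        add_mul, sub_mul, ite_mul, one_mul, zero_mul, sum_add_distrib, sum_sub_distrib,
        sum_ite_eq', mem_univ, if_true]
    have hk' : ∑ i, |n i| ≤ (k : ℤ) + 1 := by simpa using hk
    rcases lt_trichotomy (t i₀) (t j₀) with hlt | heq | hgt
    · -- peel the longer cell `t j₀` on the negative side
      set n₂ : Option ι → ℤ := fun o => o.elim (-1) n₁ with hn₂
      set t₂ : Option ι → ℝ := fun o => o.elim (t j₀ - t i₀) t with ht₂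
      have hpos₂ : ∀ o, 0 < t₂ o := by
        rintro (_ | i)
        · simpa [ht₂] using hlt
        · simpa [ht₂] using hpos i
      have hg₂ : ∀ o, good (t₂ o) := by
        rintro (_ | i)
        · simpa [ht₂] using hgood (hg i₀) (hg j₀) hlt
        · simpa [ht₂] using hg i
      have hrel₂ : ∑ o, (n₂ o : ℝ) * t₂ o = 0 := by
        rw [Fintype.sum_option]
        simp only [hn₂, ht₂, Option.elim_none, Option.elim_some, hsum_rel, hrel]
        push_cast
        ring
      have hk₂ : ∑ o, |n₂ o| ≤ (k : ℤ) := by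
        rw [Fintype.sum_option]
        simp only [hn₂, Option.elim_none, Option.elim_some, hsum_abs]
        norm_num
        linarith
      have hR := ih n₂ t₂ hpos₂ hg₂ hrel₂ hk₂
      rw [Fintype.sum_option] at hR
      simp only [hn₂, ht₂, Option.elim_none, Option.elim_some, hsum_cell, neg_smul, one_smul]
        at hR
      have hP := hpeel (hg i₀) (hg j₀) (hpos i₀) hlt
      have := G.sub_mem hR hP
      convert this using 1
      abel
    · -- equal lengths: plain cancellation
      have hrel₁ : ∑ i, (n₁ i : ℝ) * t i = 0 := by rw [hsum_rel, hrel, heq]; ring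
      have hk₁ : ∑ i, |n₁ i| ≤ (k : ℤ) := by rw [hsum_abs]; linarith
      have hR := ih n₁ t hpos hg hrel₁ hk₁
      rw [hsum_cell, heq] at hR
      simpa using hR
    · -- peel the longer cell `t i₀` on the positive side
      set n₂ : Option ι → ℤ := fun o => o.elim 1 n₁ with hn₂
      set t₂ : Option ι → ℝ := fun o => o.elim (t i₀ - t j₀) t with ht₂
      have hpos₂ : ∀ o, 0 < t₂ o := by
        rintro (_ | i)
        · simpa [ht₂] using hgt
        · simpa [ht₂] using hpos i
      have hg₂ : ∀ o, good (t₂ o) := by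
        rintro (_ | i)
        · simpa [ht₂] using hgood (hg j₀) (hg i₀) hgt
        · simpa [ht₂] using hg i
      have hrel₂ : ∑ o, (n₂ o : ℝ) * t₂ o = 0 := by
        rw [Fintype.sum_option]
        simp only [hn₂, ht₂, Option.elim_none, Option.elim_some, hsum_rel, hrel]
        push_cast
        ring
      have hk₂ : ∑ o, |n₂ o| ≤ (k : ℤ) := by
        rw [Fintype.sum_option]
        simp only [hn₂, Option.elim_none, Option.elim_some, hsum_abs]
        norm_num
        linarith
      have hR := ih n₂ t₂ hpos₂ hg₂ hrel₂ hk₂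
      rw [Fintype.sum_option] at hR
      simp only [hn₂, ht₂, Option.elim_none, Option.elim_some, hsum_cell, one_smul] at hR
      have hP := hpeel (hg j₀) (hg i₀) (hpos j₀) hgt
      have := G.add_mem hR hP
      convert this using 1
      abel

/-- **The peeling induction.** If `G` contains every peeling element
`cell s − cell t − cell (s − t)` (`0 < t < s` admissible, admissibility closed under such
differences), then every integer relation `Σ_i n_i t_i = 0` among admissible positive lengths is
realised in `G`: `Σ_i n_i • cell (t_i) ∈ G`. -/
theorem sum_zsmul_mem_of_peel
    (hgood : ∀ ⦃t s : ℝ⦄, good t → good s → t < s → good (s - t))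
    (hpeel : ∀ ⦃t s : ℝ⦄, good t → good s → 0 < t → t < s → cell s - cell t - cell (s - t) ∈ G)
    {ι : Type u} [Fintype ι] (n : ι → ℤ) (t : ι → ℝ) (hpos : ∀ i, 0 < t i)
    (hg : ∀ i, good (t i)) (hrel : ∑ i, (n i : ℝ) * t i = 0) :
    ∑ i, n i • cell (t i) ∈ G :=
  sum_zsmul_mem_of_peel_aux G good cell hgood hpeel (∑ i, |n i|).toNat n t hpos hg hrel
    (Int.self_le_toNat _)

end Peel

end SoloBlind

end Summit.KontsevichZagierPeriods.KontsevichZagierPeriods.Theorems
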